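import Literature.MathematicalPhysics.QuantumFieldTheory.Balaban1983to89.TreeLengthTorusTransfer
import Literature.MathematicalPhysics.QuantumFieldTheory.Balaban1983to89.B16Ineq197ClassOne

/-!
# T⁴ programme (cell `pub-balaban`, sub-cell `t4`) — THE BLOCK REFINEMENT BETWEEN pv22's TWO NESTED TORI, CONSTRUCTED:
# `trefine L N' Z` = the L^d fine cubes (torus with L·N′ cubes per direction) of each block of a family `Z` of cubes of the
# coarse torus (N′ blocks per direction); it is a torus localization domain when `Z` is, its block image is `Z`, and the
# coarse tree length is dominated by the refined one — [Dimock2013] Lemma 10's exact coarsening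
# (`TreeLengthTorusTransfer.mul_torusTreeLen_image_le`) BY NAME

Crew seat `b2b-balaban-t4-ne1p-formalise-leaf-05` (LEAF PROVER 05, generation 11), NE1′ formalisation crew (row NE1′, owner
lineage t4-ne1p-p1); crew row S43 ∕ DAG N29zzu «THE L-REFINEMENT BETWEEN THE TWO TORI, CONSTRUCTED» PART 1 (INTENT `CLAIMS.log` 2026-08-20 l.19903,
BOOKED typer R-T126 l.19928 — placement under `Support/` confirmed; X-read X168).  OUR lattice-combinatorics construction, Summits-side (LEAN PLACEMENT RULE); imports pv22's
`Literature/…/TreeLengthTorusTransfer` (two nested tori `TPt d (L·N′)` ∕ `TPt d N′`, the block map `tcoarse`, `tcoarse_proj`,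
`coarse_add_period`, exact coarsening `mul_torusTreeLen_image_le`) and the b16 sub-cell's `Literature/…/B16Ineq197ClassOne`
(the WINDOW refinement `fineCubes`, `corner`, `coarse_corner`, `mem_fineCubes_coarse`, `faceConnected_fineCubes`) ONLY; nothing
of theirs is restated — used BY NAME.

WHY THIS FILE.  The NE1′ crew's two-tori faces (S34 PART 2 `DressedSmallFieldCoveringFamiliesFaces.attachedPart_locE_le_of_
coresAt_pencil_families_torus`, S39 `DressedSmallFieldFamilyAmplitudeFaces.…_radii_torus` ∕ `muPart_…_families_torus`) read the
step geometry at `tgeometry 4 N` and the scale-`k` geometry at `tgeometry 4 M` and DISPLAY a footprint map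
`foot : (tsys 4 N).Dom → (tsys 4 M).Dom` with `hmono : torusTreeLen Z.1 ≤ torusTreeLen (foot Z).1` ((2.36) KIND, factor 1); the
typer's rider (R-T124 (ii) ∕ R-T125 (iii)): «the L-refinement between the two tori is NOT constructed here».  THIS FILE constructs it
for `M = L·N`: §1 the refinement `trefine L N' Z := {a | tcoarse L N' a ∈ Z}` and its window description (every fine cube of the
universal cover whose block projects into `Z` projects into `trefine Z`); §2 its block image is `Z` and it is non-empty with `Z`;
§3 it is torus-face-connected when `Z` is — inside one block and across two wall-adjacent blocks by the b16 WINDOW lemma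
`faceConnected_fineCubes` on `fineCubes L {β, β'}` pushed through pv22's `tLinked_image`, the wrap-around walls of the coarse
torus handled by pv22's `exists_lift_adj` and the deck transformations `exists_period_of_proj_eq` ∕ `coarse_add_period`;
§4 `trefineDom L N' : TDom d N' → TDom d (L·N')` and **`torusTreeLen_le_trefine`**: `torusTreeLen Z.1 ≤ torusTreeLen (trefineDom
L N' Z).1` — [Dimock2013] Lemma 10's exact coarsening `L·d_{k+1}(X̄′) ≤ d_k(X̄)` (pv22 `mul_torusTreeLen_image_le`, cite-tagged)
at `X̄ := trefine Z`, whose block family `X̄′` IS `Z`, and `L ≥ 1` (indeed `L·torusTreeLen Z.1 ≤ torusTreeLen (trefine Z)`,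
`mul_torusTreeLen_le_trefine`).  At `L = 1` the refinement is the identity up to the cast `TPt d (1·N′) = TPt d N′` (`tcoarse 1 N′`
is `proj ∘ natLift`) — consistent with the crew's `foot := id` toys (W45 ∕ W47 ∕ W48), which read both sockets at one scale.  PART 2
(`Spine/NE1p/DressedSmallFieldRefinedFaces`) re-fires the three two-tori ENDs at `foot := trefineDom L N`, `hmono := torusTreeLen_le_trefine`.
HONEST FRAMING.  Elementary lattice combinatorics on the periodic index model `(ℤ/N)^d` + one application of a published,
tree-proved lemma BY NAME; no statement of the audited manuscripts is asserted; WHICH pair of nested tori `(N′, L·N′)` is Bałaban's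
`(𝐃_{k+1}, 𝐃_k)` is pv22's READING (DIVERGENCE D-pv22.3), not asserted here; [folklore] tags only.  Nothing of NE1′'s wall moves
(v1.7 of record, T4-DAG v45); NE1′ ⇐ the named binders — NOT printed, NOT proved; spine PROVED 0∕9; count 9 unchanged.  Rung (B)+1 on
ONE finite four-torus — NOT infinite volume, NOT a mass gap, NOT OS on ℝ⁴, NOT Clay.  HONEST DEPENDENCY: continuum YM on T⁴ ⇐
BetaPertH ∧ nine spine estimates (0/9 proved); BetaPertH ⇐ (D1) ∧ (D4) ∧ CAP+tail; G-an2-4 gates asym, D1 and NE2/3/4.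
-/

namespace Summit.QuantumFields.BalabanUV.T4Continuum.TorusBlockRefinement

open Literature.MathematicalPhysics.QuantumFieldTheory.Balaban1983to89.B13ScaleTransfer (Pt coarse Adj Linked FaceConnected
  coarse_eq_iff)
open Literature.MathematicalPhysics.QuantumFieldTheory.Balaban1983to89.TreeLengthTorus (TPt proj proj_apply natLift proj_natLift
  TAdj TStepIn TLinked TFaceConnected tLinked_image exists_lift_adj IsTDom TDom tsys torusTreeLen torusTreeLen_nonneg)
open Literature.MathematicalPhysics.QuantumFieldTheory.Balaban1983to89.TreeLengthTorusGeometry (period proj_add_period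
  exists_period_of_proj_eq)
open Literature.MathematicalPhysics.QuantumFieldTheory.Balaban1983to89.TreeLengthTorusTransfer (tcoarse tcoarse_proj
  coarse_add_period mul_torusTreeLen_image_le tLinked_mono tLinked_symm tLinked_trans)
open Literature.MathematicalPhysics.QuantumFieldTheory.Balaban1983to89.B13Factor210Literal (fineCubes)
open Literature.MathematicalPhysics.QuantumFieldTheory.Balaban1983to89.B16Ineq197ClassOne (corner coarse_corner
  mem_fineCubes_coarse faceConnected_fineCubes)

variable {d : ℕ}

/-! ## §1 The refinement of a family of blocks and its window description -/

section Refine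

variable (L N' : ℕ) [NeZero L] [NeZero N']

/-- THE BLOCK REFINEMENT: the cubes of the fine torus (L·N′ per direction) whose block (`tcoarse`) belongs to the family `Z` of
cubes of the coarse torus (N′ per direction) — the union of the L^d fine cubes of each block of `Z`. [folklore] -/
noncomputable def trefine (Z : Finset (TPt d N')) : Finset (TPt d (L * N')) :=
  Finset.univ.filter fun a => tcoarse L N' a ∈ Z

variable {L N'}

/-- Membership in the refinement: the block of the cube lies in `Z`. [folklore] -/
@[simp] theorem mem_trefine {Z : Finset (TPt d N')} {a : TPt d (L * N')} : a ∈ trefine L N' Z ↔ tcoarse L N' a ∈ Z := by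
  simp [trefine]

/-- WINDOW DESCRIPTION: a cube of the universal cover projects into `trefine Z` iff its block projects into `Z`. [folklore] -/
theorem proj_mem_trefine {Z : Finset (TPt d N')} {x : Pt d} :
    proj (L * N') x ∈ trefine L N' Z ↔ proj N' (coarse L x) ∈ Z := by
  rw [mem_trefine, tcoarse_proj]

/-- The image of a window refinement `fineCubes L S` projects into `trefine Z` as soon as the blocks `S` project into `Z`
(b16's `mem_fineCubes_coarse` + pv22's `tcoarse_proj`). [folklore] -/
theorem image_fineCubes_subset_trefine {Z : Finset (TPt d N')} {S : Finset (Pt d)} (hSZ : ∀ β ∈ S, proj N' β ∈ Z) :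
    (fineCubes L S).image (proj (L * N')) ⊆ trefine L N' Z := by
  have hL : 0 < L := Nat.pos_of_ne_zero (NeZero.ne L)
  intro a ha
  obtain ⟨x, hx, rfl⟩ := Finset.mem_image.1 ha
  exact proj_mem_trefine.2 (hSZ _ ((mem_fineCubes_coarse hL).1 hx))

/-- The corner cube `L·β` of the block `β` of the universal cover projects into `trefine Z` when `β` projects into `Z`. [folklore] -/
theorem proj_corner_mem_trefine {Z : Finset (TPt d N')} {β : Pt d} (hβ : proj N' β ∈ Z) :
    proj (L * N') (corner L β) ∈ trefine L N' Z := by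
  have hL : 0 < L := Nat.pos_of_ne_zero (NeZero.ne L)
  rw [proj_mem_trefine, coarse_corner hL]
  exact hβ

/-- The block of the corner cube `L·(natLift b)` is `b`. [folklore] -/
theorem tcoarse_proj_corner (b : TPt d N') : tcoarse L N' (proj (L * N') (corner L (natLift b))) = b := by
  have hL : 0 < L := Nat.pos_of_ne_zero (NeZero.ne L)
  rw [tcoarse_proj, coarse_corner hL, proj_natLift]

/-- The standard lift of a torus cube index lies in the fundamental box `[0, N)^d`. [folklore] -/
theorem natLift_nonneg_lt {N : ℕ} [NeZero N] (a : TPt d N) (i : Fin d) : 0 ≤ natLift a i ∧ natLift a i < N := by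
  refine ⟨?_, ?_⟩
  · show (0 : ℤ) ≤ ((a i).val : ℤ)
    positivity
  · show ((a i).val : ℤ) < (N : ℤ)
    exact_mod_cast ZMod.val_lt (a i)

/-- On the fundamental box `[0, N)^d` the standard lift inverts the projection. [folklore] -/
theorem natLift_proj_of_range {N : ℕ} [NeZero N] {x : Pt d} (hx : ∀ i, 0 ≤ x i ∧ x i < N) : natLift (proj N x) = x := by
  funext i
  simp only [natLift, proj_apply, ZMod.val_intCast]
  exact Int.emod_eq_of_lt (hx i).1 (hx i).2

/-- The block of a fine cube, read on the universal cover through the standard lifts: `coarse L (natLift a) = natLift (tcoarse a)`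
(the standard lift of a fine cube lies in `[0, L·N′)^d`, so its block index lies in `[0, N′)^d`). [folklore] -/
theorem coarse_natLift (a : TPt d (L * N')) : coarse L (natLift a) = natLift (tcoarse L N' a) := by
  have hL : 0 < L := Nat.pos_of_ne_zero (NeZero.ne L)
  have hL' : (0 : ℤ) < L := by exact_mod_cast hL
  have hrange : ∀ i, 0 ≤ coarse L (natLift a) i ∧ coarse L (natLift a) i < N' := by
    intro i
    obtain ⟨h0, h1⟩ := natLift_nonneg_lt a i
    refine ⟨Int.ediv_nonneg h0 hL'.le, ?_⟩
    have h1' : natLift a i < (N' : ℤ) * (L : ℤ) := by push_cast at h1; linarith [mul_comm (N' : ℤ) (L : ℤ)]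
    exact (Int.ediv_lt_iff_lt_mul hL').2 h1'
  unfold tcoarse
  rw [natLift_proj_of_range hrange]

end Refine

/-! ## §2 The block image of the refinement is the family itself; non-emptiness -/

section Image

variable {L N' : ℕ} [NeZero L] [NeZero N']

/-- THE BLOCKS MET BY THE REFINEMENT ARE EXACTLY `Z` (`tcoarse ∘ trefine = id` on families of blocks). [folklore] -/
theorem image_tcoarse_trefine (Z : Finset (TPt d N')) : (trefine L N' Z).image (tcoarse L N') = Z := by
  ext b
  constructor
  · intro hb
    obtain ⟨a, ha, rfl⟩ := Finset.mem_image.1 hb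
    exact mem_trefine.1 ha
  · intro hb
    exact Finset.mem_image.2 ⟨proj (L * N') (corner L (natLift b)),
      mem_trefine.2 (by rw [tcoarse_proj_corner]; exact hb), tcoarse_proj_corner b⟩

/-- The refinement of a non-empty family is non-empty. [folklore] -/
theorem trefine_nonempty {Z : Finset (TPt d N')} (hZ : Z.Nonempty) : (trefine L N' Z).Nonempty := by
  obtain ⟨b, hb⟩ := hZ
  exact ⟨proj (L * N') (corner L (natLift b)), mem_trefine.2 (by rw [tcoarse_proj_corner]; exact hb)⟩

end Image

/-! ## §3 The refinement of a torus localization domain is a torus localization domain -/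

section Connected

variable {L N' : ℕ} [NeZero L] [NeZero N']

/-- A one- or two-block window family that is face-connected links all its fine cubes INSIDE `trefine Z` once its blocks project
into `Z` (b16's `faceConnected_fineCubes` on the universal cover, projected by pv22's `tLinked_image`, enlarged by
`image_fineCubes_subset_trefine`). [folklore] -/
theorem tLinked_trefine_of_window {Z : Finset (TPt d N')} {S : Finset (Pt d)} (hS : FaceConnected S)
    (hSZ : ∀ β ∈ S, proj N' β ∈ Z) {x x' : Pt d} (hx : x ∈ fineCubes L S) (hx' : x' ∈ fineCubes L S) :
    TLinked (trefine L N' Z) (proj (L * N') x) (proj (L * N') x') := by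
  have hL : 0 < L := Nat.pos_of_ne_zero (NeZero.ne L)
  exact tLinked_mono (image_fineCubes_subset_trefine hSZ) (tLinked_image (faceConnected_fineCubes hL hS x hx x' hx'))

/-- A singleton window family is face-connected. [folklore] -/
theorem faceConnected_singleton (β : Pt d) : FaceConnected ({β} : Finset (Pt d)) := by
  intro x hx y hy
  rw [Finset.mem_singleton] at hx hy
  subst hx; subst hy
  exact Relation.ReflTransGen.refl

/-- A window family of two wall-adjacent blocks is face-connected. [folklore] -/
theorem faceConnected_pair {β β' : Pt d} (h : Adj β β') : FaceConnected ({β, β'} : Finset (Pt d)) := by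
  have hβ : β ∈ ({β, β'} : Finset (Pt d)) := by simp
  have hβ' : β' ∈ ({β, β'} : Finset (Pt d)) := by simp
  have hl : Linked ({β, β'} : Finset (Pt d)) β β' := Relation.ReflTransGen.single ⟨hβ, hβ', h⟩
  intro x hx y hy
  simp only [Finset.mem_insert, Finset.mem_singleton] at hx hy
  rcases hx with rfl | rfl <;> rcases hy with rfl | rfl
  · exact Relation.ReflTransGen.refl
  · exact hl
  · exact hl.symm
  · exact Relation.ReflTransGen.refl

/-- INSIDE ONE BLOCK: two fine cubes of the same block `b ∈ Z` are chain-connected inside `trefine Z`. [folklore] -/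
theorem tLinked_trefine_same_block {Z : Finset (TPt d N')} {a a' : TPt d (L * N')} (ha : tcoarse L N' a ∈ Z)
    (h : tcoarse L N' a' = tcoarse L N' a) : TLinked (trefine L N' Z) a a' := by
  have hL : 0 < L := Nat.pos_of_ne_zero (NeZero.ne L)
  set β : Pt d := natLift (tcoarse L N' a) with hβdef
  have hSZ : ∀ γ ∈ ({β} : Finset (Pt d)), proj N' γ ∈ Z := by
    intro γ hγ; rw [Finset.mem_singleton] at hγ; subst hγ; rw [hβdef, proj_natLift]; exact ha
  have hx : natLift a ∈ fineCubes L ({β} : Finset (Pt d)) :=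
    (mem_fineCubes_coarse hL).2 (by rw [Finset.mem_singleton, coarse_natLift])
  have hx' : natLift a' ∈ fineCubes L ({β} : Finset (Pt d)) :=
    (mem_fineCubes_coarse hL).2 (by rw [Finset.mem_singleton, coarse_natLift, h])
  have hl := tLinked_trefine_of_window (faceConnected_singleton β) hSZ hx hx'
  rwa [proj_natLift, proj_natLift] at hl

/-- ACROSS A WALL OF THE COARSE TORUS (wrap-around walls included): if the blocks `c ~ c'` both lie in `Z`, the corner cube of `c`
is chain-connected inside `trefine Z` to every fine cube of the block `c'` (pv22's `exists_lift_adj` lifts the torus wall to the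
universal cover; the deck transformation `exists_period_of_proj_eq` ∕ `coarse_add_period` moves the standard lift of the fine cube
into the lifted block). [folklore] -/
theorem tLinked_trefine_adj_block {Z : Finset (TPt d N')} {c c' : TPt d N'} (hc : c ∈ Z) (hc' : c' ∈ Z) (hadj : TAdj c c')
    {a' : TPt d (L * N')} (ha' : tcoarse L N' a' = c') :
    TLinked (trefine L N' Z) (proj (L * N') (corner L (natLift c))) a' := by
  have hL : 0 < L := Nat.pos_of_ne_zero (NeZero.ne L)
  -- lift the coarse wall to the universal cover
  have hadj' : TAdj (proj N' (natLift c)) c' := by rwa [proj_natLift]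
  obtain ⟨β', hβ'c, hββ'⟩ := exists_lift_adj hadj'
  -- the standard lift of `a'` has block `natLift c'`, which differs from `β'` by a period of the coarse torus
  have hcoarse : coarse L (natLift a') = natLift c' := by rw [coarse_natLift, ha']
  obtain ⟨k, hk⟩ : ∃ k : Pt d, β' = natLift c' + period N' k :=
    exists_period_of_proj_eq (by rw [proj_natLift, hβ'c])
  set x' : Pt d := natLift a' + period (L * N') k with hx'def
  have hx'coarse : coarse L x' = β' := by rw [hx'def, coarse_add_period hL N', hcoarse, hk]
  have hx'proj : proj (L * N') x' = a' := by rw [hx'def, proj_add_period, proj_natLift]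
  -- the two-block window family {natLift c, β'}
  have hSZ : ∀ γ ∈ ({natLift c, β'} : Finset (Pt d)), proj N' γ ∈ Z := by
    intro γ hγ
    simp only [Finset.mem_insert, Finset.mem_singleton] at hγ
    rcases hγ with rfl | rfl
    · rw [proj_natLift]; exact hc
    · rw [hβ'c]; exact hc'
  have hx : corner L (natLift c) ∈ fineCubes L ({natLift c, β'} : Finset (Pt d)) :=
    (mem_fineCubes_coarse hL).2 (by rw [coarse_corner hL]; simp)
  have hx' : x' ∈ fineCubes L ({natLift c, β'} : Finset (Pt d)) :=
    (mem_fineCubes_coarse hL).2 (by rw [hx'coarse]; simp)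
  have hl := tLinked_trefine_of_window (faceConnected_pair hββ') hSZ hx hx'
  rwa [hx'proj] at hl

/-- **THE REFINEMENT OF A TORUS LOCALIZATION DOMAIN IS TORUS-FACE-CONNECTED** (chains of blocks of `Z` lift to chains of fine cubes:
inside a block by `tLinked_trefine_same_block`, across each wall by `tLinked_trefine_adj_block`). [folklore] -/
theorem tFaceConnected_trefine {Z : Finset (TPt d N')} (hZ : TFaceConnected Z) : TFaceConnected (trefine L N' Z) := by
  intro a ha a' ha'
  have hb : tcoarse L N' a ∈ Z := mem_trefine.1 ha
  have hb' : tcoarse L N' a' ∈ Z := mem_trefine.1 ha'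
  -- induct along a chain of blocks from the block of `a` to the block of `a'`
  have key : ∀ c, TLinked Z (tcoarse L N' a) c → ∀ a'' : TPt d (L * N'), tcoarse L N' a'' = c →
      TLinked (trefine L N' Z) a a'' := by
    intro c hchain
    induction hchain with
    | refl => exact fun a'' ha'' => tLinked_trefine_same_block hb ha''
    | tail _ hstep ih =>
        intro a'' ha''
        obtain ⟨hcZ, hc'Z, hcc'⟩ := hstep
        -- reach the corner of the block `c`, then cross the wall into the block `c'`
        have h1 := ih (proj (L * N') (corner L (natLift _))) (tcoarse_proj_corner _)
        exact tLinked_trans h1 (tLinked_trefine_adj_block hcZ hc'Z hcc' ha'')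
  exact key _ (hZ _ hb _ hb') a' rfl

end Connected

/-! ## §4 The refinement as a map of torus catalogues; the coarse tree length is dominated by the refined one -/

section Dom

variable (L N' : ℕ) [NeZero L] [NeZero N']

/-- THE REFINEMENT AS A MAP BETWEEN THE TWO TORUS CATALOGUES `𝐃(N′) → 𝐃(L·N′)`: a torus localization domain of the coarse torus
refines to a torus localization domain of the fine torus (`trefine_nonempty`, `tFaceConnected_trefine`). [folklore] -/
noncomputable def trefineDom (Z : TDom d N') : TDom d (L * N') :=
  ⟨trefine L N' Z.1, trefine_nonempty Z.2.1, tFaceConnected_trefine Z.2.2⟩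

variable {L N'}

/-- The cubes of the refined domain. [folklore] -/
@[simp] theorem trefineDom_val (Z : TDom d N') : (trefineDom L N' Z).1 = trefine L N' Z.1 := rfl

/-- **EXACT COARSENING, READ UPWARD**: `L · torusTreeLen Z.1 ≤ torusTreeLen (trefine Z.1)` for every torus localization domain `Z`
of the coarse torus — [Dimock2013] §3 Lemma 10's `L·d_{LM}(X̄′) ≤ d_M(X̄)` (pv22's `TreeLengthTorusTransfer.mul_torusTreeLen_image_le`,
BY NAME) at `X̄ := trefine Z`, whose block family `X̄′` is `Z` (`image_tcoarse_trefine`). [folklore] -/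
theorem mul_torusTreeLen_le_trefine (Z : TDom d N') :
    (L : ℝ) * torusTreeLen Z.1 ≤ torusTreeLen (trefine L N' Z.1) := by
  have h := mul_torusTreeLen_image_le (trefine_nonempty (L := L) Z.2.1) (tFaceConnected_trefine (L := L) Z.2.2)
  rwa [image_tcoarse_trefine] at h

/-- **THE DISPLAYED `hmono` OF THE TWO-TORI FACES, DISCHARGED**: `torusTreeLen Z.1 ≤ torusTreeLen (trefineDom L N' Z).1` — the
coarse tree length of a torus localization domain is at most the fine tree length of its refinement (`L ≥ 1`; the (2.36)-KIND
direction `d_{k+1}(Z) ≤ d_k(Z read at scale k)` with factor 1). [folklore] -/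
theorem torusTreeLen_le_trefine (Z : TDom d N') : torusTreeLen Z.1 ≤ torusTreeLen (trefineDom L N' Z).1 := by
  have hL : (1 : ℝ) ≤ L := by exact_mod_cast Nat.pos_of_ne_zero (NeZero.ne L)
  calc torusTreeLen Z.1 ≤ (L : ℝ) * torusTreeLen Z.1 := le_mul_of_one_le_left (torusTreeLen_nonneg _) hL
    _ ≤ torusTreeLen (trefineDom L N' Z).1 := mul_torusTreeLen_le_trefine Z

end Dom

end Summit.QuantumFields.BalabanUV.T4Continuum.TorusBlockRefinement
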